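import Literature.AlgebraicGeometry.Motives.HypersurfaceCharts
import Literature.AlgebraicGeometry.Motives.GrpObjOfAlgPoints
import Literature.NumberTheory.EllipticCurves.WeierstrassSchemeCharts
import Literature.NumberTheory.EllipticCurves.WeierstrassSchemePoints
import HarnessLib

/-!
# Affine pieces of `E_W ×_K E_W` and their points

For a Weierstrass curve `W` over a field `K` with plane cubic `E_W = V₊(F) ⊂ ℙ²_K`
(`WeierstrassCurve.scheme`), this file sets up the affine opens on which the addition morphism will
be written down by formulas (Silverman, *AEC* III.3.6, proof):

* the three coordinate charts `crChart W i : Spec Aᵢ ↪ E_W` (`Aᵢ = W.CRing i`, the chart ring of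
  `E_W ∩ D₊(xᵢ)` of `Motives/HypersurfaceCharts`) with their tautological coordinate vectors
  `ctaut W i = (xⱼ/xᵢ)ⱼ`, the covering of `E_W` by the charts `i = 1, 2`
  (`exists_mem_range_crChart`, from `WeierstrassScheme.mem_basicOpen_or`), and **the `L`-points
  through a chart**: `Spec α ≫ crChart i = [α(x₀/xᵢ) : α(x₁/xᵢ) : α(x₂/xᵢ)]`
  (`specOverOfAlgHom_comp_crChart`, via `liftVec` / `specOverOfAlgHom_liftVec_chart_hypersurfaceι`);
* the nine **affine pieces** `pieceι W c d : Spec (A_c ⊗_K A_d) ↪ E_W ×_K E_W` over `K` (the pairing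
  of the two charts), open immersions (`Spec (A_c ⊗ A_d) ≅ Spec A_c ×_K Spec A_d`, Mathlib
  `pullbackSpecIso`, followed by `pullback.map` of the charts) with image
  `pr₁⁻¹(E ∩ D₊(x_c)) ∩ pr₂⁻¹(E ∩ D₊(x_d))` (`range_pieceι_left`, Mathlib `Scheme.Pullback.range_map`),
  covering `E_W ×_K E_W` (`exists_mem_range_pieceι`); their coordinate rings are reduced for `W`
  elliptic (`isReduced_pieceRing`: opens of the integral `E_W ×_K E_W`);
* **the two projections of an `L`-point of a piece**: `Spec φ ≫ pieceι ≫ prₖ` is the point whose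
  homogeneous coordinates are `φ` of the tautological vector of the `k`-th factor
  (`specOverOfAlgHom_pieceι_fst`, `specOverOfAlgHom_pieceι_snd`).

## References

* J. H. Silverman, *The Arithmetic of Elliptic Curves*, 2nd ed. (2009): III.3.6 (proof). [SilvermanAEC2009]
* R. Hartshorne, *Algebraic Geometry* (1977): II Thm. 3.3 (products glued from affine pieces). [Hartshorne1977]
-/

noncomputable section

open CategoryTheory AlgebraicGeometry MonoidalCategory CartesianMonoidalCategory Limits MvPolynomial
open Literature.AlgebraicGeometry.Motives
open scoped TensorProduct

universe u

-- tree idiom for scheme-level rewriting through the `Over`/pullback API (cf. `Motives/ProjSubscheme*`)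
set_option backward.isDefEq.respectTransparency false

namespace WeierstrassCurve

variable {K : Type u} [Field K] (W : WeierstrassCurve K)

attribute [local instance] MvPolynomial.gradedAlgebra ProjBaseChange.algebraBase

/-! ### The coordinate charts and their points -/

/-- The coordinate ring `Aᵢ` of the chart `E_W ∩ D₊(xᵢ)` (`Motives/HypersurfaceCharts.ChartRing`). [folklore] -/
abbrev CRing (i : Fin 3) : Type u :=
  SmoothHypersurface.ChartRing (n := 1) W.toProjective.polynomial i W.toProjective.isHomogeneous_polynomial

/-- The chart `Spec Aᵢ ↪ E_W` over `K` (`Motives/HypersurfaceCharts.chart`). [folklore] -/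
abbrev crChart (i : Fin 3) : specOver K (W.CRing i) ⟶ W.scheme :=
  SmoothHypersurface.chart (n := 1) W.toProjective.polynomial i W.toProjective.isHomogeneous_polynomial
    three_pos

/-- The tautological coordinate vector `(xⱼ/xᵢ)ⱼ ∈ Aᵢ³`. [folklore] -/
abbrev ctaut (i : Fin 3) : Fin 3 → W.CRing i :=
  SmoothHypersurface.tautVec (n := 1) W.toProjective.polynomial i W.toProjective.isHomogeneous_polynomial

/-- `(ctaut i) i = 1`. [folklore] -/
theorem ctaut_self (i : Fin 3) : W.ctaut i i = 1 :=
  SmoothHypersurface.tautVec_self _ _ _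

/-- `F(ctaut i) = 0`. [folklore] -/
theorem aeval_ctaut (i : Fin 3) : aeval (W.ctaut i) W.toProjective.polynomial = 0 :=
  SmoothHypersurface.aeval_tautVec_eq_zero _ _ _

/-- The image of the chart `Spec Aᵢ ↪ E_W` is `E_W ∩ D₊(xᵢ)`. [folklore] -/
theorem range_crChart_left (i : Fin 3) :
    Set.range (W.crChart i).left = ((W.schemeι.left ⁻¹ᵁ
      Proj.basicOpen (homogeneousSubmodule (Fin (1 + 2)) K) (X i) : W.scheme.left.Opens) : Set W.scheme.left) :=
  SmoothHypersurface.range_chart_left _ _ _ _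

/-- **`E_W` is covered by the charts `x₁ ≠ 0` and `x₂ ≠ 0`** (a point with `x₁ = x₂ = 0` would have
`x₀³ = 0`; `WeierstrassScheme.mem_basicOpen_or`). [cite: SilvermanAEC2009, III.1] -/
theorem exists_mem_range_crChart (e : W.scheme.left) : ∃ i : Fin 3, e ∈ Set.range (W.crChart i).left := by
  rcases Literature.NumberTheory.EllipticCurves.WeierstrassScheme.mem_basicOpen_or W e with h | h
  · exact ⟨1, by rw [range_crChart_left]; exact h⟩
  · exact ⟨2, by rw [range_crChart_left]; exact h⟩

section ChartPoints

variable {L : Type u} [Field L] [Algebra K L]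

/-- The coordinate vector of the `L`-point `α` of `Spec Aᵢ` is non-zero (its `i`-th entry is `1`).
[folklore] -/
theorem crVec_ne_zero (i : Fin 3) (α : W.CRing i →ₐ[K] L) : (fun j ↦ α (W.ctaut i j)) ≠ 0 := by
  intro h
  have h1 := congr_fun h i
  simp only [ctaut_self, map_one, Pi.zero_apply] at h1
  exact one_ne_zero h1

/-- The coordinate vector of an `L`-point of `Spec Aᵢ` satisfies the Weierstrass equation. [folklore] -/
theorem equation_crVec (i : Fin 3) (α : W.CRing i →ₐ[K] L) :
    (W.baseChange L).toProjective.Equation (fun j ↦ α (W.ctaut i j)) := by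
  rw [← W.aeval_toProjective_polynomial_eq_zero_iff, ← MvPolynomial.comp_aeval, AlgHom.comp_apply,
    aeval_ctaut, map_zero]

/-- **The `L`-point `Spec L → Spec Aᵢ → E_W` is the point with homogeneous coordinates
`(α(xⱼ/xᵢ))ⱼ`.** [cite: SilvermanAEC2009, III.1] -/
theorem specOverOfAlgHom_comp_crChart (i : Fin 3) (α : W.CRing i →ₐ[K] L) :
    specOverOfAlgHom α ≫ W.crChart i =
      W.schemePoint (fun j ↦ α (W.ctaut i j)) (W.crVec_ne_zero i α) (W.equation_crVec i α) := by
  set v : Fin 3 → L := fun j ↦ α (W.ctaut i j) with hvdef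
  have hvi : v i = 1 := by rw [hvdef]; change α (W.ctaut i i) = 1; rw [ctaut_self, map_one]
  have hz : aeval v (X i : MvPolynomial (Fin 3) K) ≠ 0 := by rw [aeval_X, hvi]; exact one_ne_zero
  have hv : IsUnit (aeval v (X i : MvPolynomial (Fin 3) K)) := isUnit_iff_ne_zero.mpr hz
  have hFv : aeval v W.toProjective.polynomial = 0 :=
    (W.aeval_toProjective_polynomial_eq_zero_iff v).mpr (W.equation_crVec i α)
  have hu : hv.unit = 1 := Units.ext (by rw [IsUnit.unit_spec, aeval_X, hvi, Units.val_one])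
  have hα : α = SmoothHypersurface.liftVec (n := 1) W.toProjective.polynomial i
      W.toProjective.isHomogeneous_polynomial v hv hFv := by
    refine SmoothHypersurface.algHom_ext_tautVec _ _ _ fun j ↦ ?_
    rw [SmoothHypersurface.liftVec_tautVec, hu, inv_one, Units.val_one, mul_one]
  have hL : specOverOfAlgHom α ≫ W.crChart i ≫ W.schemeι =
      ProjectiveSpace.vecChartPoint (ProjectiveSpace.X_mem i) one_pos v hv := by
    rw [hα]
    exact SmoothHypersurface.specOverOfAlgHom_liftVec_chart_hypersurfaceι (n := 1) W.toProjective.polynomial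
      i W.toProjective.isHomogeneous_polynomial three_pos v hv hFv
  apply AlgPoints.map_injective_of_mono W.schemeι
  rw [AlgPoints.map_apply, Category.assoc, hL, map_schemeι_schemePoint,
    ProjectiveSpace.pointOfVec_eq_chartPoint v _ (ProjectiveSpace.X_mem i) one_pos hz]
  rfl

end ChartPoints

/-! ### The affine pieces of `E_W ×_K E_W` -/

/-- The coordinate ring `A_c ⊗_K A_d` of the piece `(E ∩ D₊(x_c)) ×_K (E ∩ D₊(x_d))`. [folklore] -/
abbrev PieceRing (c d : Fin 3) : Type u := W.CRing c ⊗[K] W.CRing d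

/-- **The affine piece `Spec (A_c ⊗_K A_d) → E_W ×_K E_W` over `K`**: the pairing of the two
charts (Silverman, *AEC* III.3.6, proof; Hartshorne II Thm. 3.3). [cite: SilvermanAEC2009, III.3.6] -/
def pieceι (c d : Fin 3) : specOver K (W.PieceRing c d) ⟶ W.scheme ⊗ W.scheme :=
  lift (specOverOfAlgHom (Algebra.TensorProduct.includeLeft : W.CRing c →ₐ[K] W.PieceRing c d) ≫ W.crChart c)
    (specOverOfAlgHom (Algebra.TensorProduct.includeRight : W.CRing d →ₐ[K] W.PieceRing c d) ≫ W.crChart d)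

/-- First projection of the piece: the first chart. [folklore] -/
@[reassoc]
theorem pieceι_fst (c d : Fin 3) : W.pieceι c d ≫ fst _ _ =
    specOverOfAlgHom (Algebra.TensorProduct.includeLeft : W.CRing c →ₐ[K] W.PieceRing c d) ≫ W.crChart c :=
  lift_fst _ _

/-- Second projection of the piece: the second chart. [folklore] -/
@[reassoc]
theorem pieceι_snd (c d : Fin 3) : W.pieceι c d ≫ snd _ _ =
    specOverOfAlgHom (Algebra.TensorProduct.includeRight : W.CRing d →ₐ[K] W.PieceRing c d) ≫ W.crChart d :=
  lift_snd _ _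

section PiecePoints

variable {L : Type u} [Field L] [Algebra K L] (c d : Fin 3) (φ : W.PieceRing c d →ₐ[K] L)

/-- **First projection of the `L`-point `φ` of a piece**: the point `[φ(x_j/x_c ⊗ 1)]ⱼ`. [folklore] -/
theorem specOverOfAlgHom_pieceι_fst :
    specOverOfAlgHom φ ≫ W.pieceι c d ≫ fst _ _ =
      W.schemePoint (fun j ↦ φ (W.ctaut c j ⊗ₜ[K] 1))
        (W.crVec_ne_zero c (φ.comp Algebra.TensorProduct.includeLeft))
        (W.equation_crVec c (φ.comp Algebra.TensorProduct.includeLeft)) := by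
  rw [pieceι_fst, ← Category.assoc, ← specOverOfAlgHom_comp]
  exact W.specOverOfAlgHom_comp_crChart c (φ.comp Algebra.TensorProduct.includeLeft)

/-- **Second projection of the `L`-point `φ` of a piece**: the point `[φ(1 ⊗ x_j/x_d)]ⱼ`. [folklore] -/
theorem specOverOfAlgHom_pieceι_snd :
    specOverOfAlgHom φ ≫ W.pieceι c d ≫ snd _ _ =
      W.schemePoint (fun j ↦ φ (1 ⊗ₜ[K] W.ctaut d j))
        (W.crVec_ne_zero d (φ.comp Algebra.TensorProduct.includeRight))
        (W.equation_crVec d (φ.comp Algebra.TensorProduct.includeRight)) := by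
  rw [pieceι_snd, ← Category.assoc, ← specOverOfAlgHom_comp]
  exact W.specOverOfAlgHom_comp_crChart d (φ.comp Algebra.TensorProduct.includeRight)

end PiecePoints

/-! ### The pieces are open immersions covering `E_W ×_K E_W` -/

/-- The charts are morphisms over `K` (structure equation of the source). [folklore] -/
theorem crChart_left_over (i : Fin 3) :
    (W.crChart i).left ≫ W.scheme.hom = Spec.map (CommRingCat.ofHom (algebraMap K (W.CRing i))) :=
  Over.w (W.crChart i)

/-- Underlying morphisms: first projection. [folklore] -/
theorem pieceι_left_fst (c d : Fin 3) :
    (W.pieceι c d).left ≫ pullback.fst W.scheme.hom W.scheme.hom =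
      Spec.map (CommRingCat.ofHom (Algebra.TensorProduct.includeLeftRingHom (R := K) (A := W.CRing c)
        (B := W.CRing d))) ≫ (W.crChart c).left :=
  congrArg CommaMorphism.left (W.pieceι_fst c d)

/-- Underlying morphisms: second projection. [folklore] -/
theorem pieceι_left_snd (c d : Fin 3) :
    (W.pieceι c d).left ≫ pullback.snd W.scheme.hom W.scheme.hom =
      Spec.map (CommRingCat.ofHom (Algebra.TensorProduct.includeRight (R := K) (A := W.CRing c)
        (B := W.CRing d)).toRingHom) ≫ (W.crChart d).left :=
  congrArg CommaMorphism.left (W.pieceι_snd c d)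

/-- **`Spec (A_c ⊗ A_d) → E ×_K E` is `Spec (A_c ⊗ A_d) ≅ Spec A_c ×_K Spec A_d` followed by the product
of the two charts** (Mathlib `pullbackSpecIso`, `pullback.map`). [cite: Hartshorne1977, II Thm. 3.3] -/
theorem pieceι_left_eq (c d : Fin 3) :
    (W.pieceι c d).left =
      ((pullback.congrHom (W.crChart_left_over c) (W.crChart_left_over d)) ≪≫
          pullbackSpecIso K (W.CRing c) (W.CRing d)).inv ≫
        pullback.map _ _ _ _ (W.crChart c).left (W.crChart d).left (𝟙 _) (Category.comp_id _)
          (Category.comp_id _) := by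
  refine pullback.hom_ext ?_ ?_
  · rw [pieceι_left_fst, Category.assoc, pullback.lift_fst, Iso.trans_inv, Category.assoc,
      pullback.congrHom_inv, pullback.lift_fst_assoc, Category.comp_id, pullbackSpecIso_inv_fst_assoc]
  · rw [pieceι_left_snd, Category.assoc, pullback.lift_snd, Iso.trans_inv, Category.assoc,
      pullback.congrHom_inv, pullback.lift_snd_assoc, Category.comp_id, pullbackSpecIso_inv_snd_assoc]
    rfl

/-- The affine pieces are open immersions. [folklore] -/
instance isOpenImmersion_pieceι_left (c d : Fin 3) : IsOpenImmersion (W.pieceι c d).left := by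
  rw [pieceι_left_eq]
  infer_instance

/-- **The image of the piece is `pr₁⁻¹(E ∩ D₊(x_c)) ∩ pr₂⁻¹(E ∩ D₊(x_d))`** (Mathlib `Scheme.Pullback.range_map`).
[cite: Hartshorne1977, II Thm. 3.3] -/
theorem range_pieceι_left (c d : Fin 3) :
    Set.range (W.pieceι c d).left =
      pullback.fst W.scheme.hom W.scheme.hom ⁻¹' Set.range (W.crChart c).left ∩
        pullback.snd W.scheme.hom W.scheme.hom ⁻¹' Set.range (W.crChart d).left := by
  rw [pieceι_left_eq]
  set I := (pullback.congrHom (W.crChart_left_over c) (W.crChart_left_over d)) ≪≫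
    pullbackSpecIso K (W.CRing c) (W.CRing d)
  set m := pullback.map ((W.crChart c).left ≫ W.scheme.hom) ((W.crChart d).left ≫ W.scheme.hom)
    W.scheme.hom W.scheme.hom (W.crChart c).left (W.crChart d).left (𝟙 _) (Category.comp_id _)
    (Category.comp_id _)
  have hs : Function.Surjective I.inv.base := (Scheme.homeoOfIso I.symm).surjective
  change Set.range (m.base ∘ I.inv.base) = _
  rw [Set.range_comp, hs.range_eq, Set.image_univ]
  exact Scheme.Pullback.range_map ((W.crChart c).left ≫ W.scheme.hom) ((W.crChart d).left ≫ W.scheme.hom)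
    W.scheme.hom W.scheme.hom (W.crChart c).left (W.crChart d).left (𝟙 _) (Category.comp_id _)
    (Category.comp_id _)

/-- **The nine affine pieces cover `E_W ×_K E_W`.** [cite: SilvermanAEC2009, III.3.6] -/
theorem exists_mem_range_pieceι (x : (W.scheme ⊗ W.scheme).left) :
    ∃ (c d : Fin 3) (y : Spec (CommRingCat.of (W.PieceRing c d))), (W.pieceι c d).left y = x := by
  obtain ⟨c, hc⟩ := W.exists_mem_range_crChart (pullback.fst W.scheme.hom W.scheme.hom x)
  obtain ⟨d, hd⟩ := W.exists_mem_range_crChart (pullback.snd W.scheme.hom W.scheme.hom x)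
  have hx : x ∈ Set.range (W.pieceι c d).left := by
    rw [range_pieceι_left]
    exact ⟨hc, hd⟩
  obtain ⟨y, hy⟩ := hx
  exact ⟨c, d, y, hy⟩

/-- The pieces are morphisms over `K` (structure equation of the source). [folklore] -/
theorem pieceι_left_over (c d : Fin 3) :
    (W.pieceι c d).left ≫ (W.scheme ⊗ W.scheme).hom = Spec.map (CommRingCat.ofHom (algebraMap K (W.PieceRing c d))) :=
  Over.w (W.pieceι c d)

/-- For `W` elliptic the coordinate rings of the pieces are reduced (opens of the integral
`E_W ×_K E_W`). [folklore] -/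
instance isReduced_pieceRing [W.IsElliptic] (c d : Fin 3) : IsReduced (W.PieceRing c d) := by
  haveI : AlgebraicGeometry.IsIntegral (W.scheme ⊗ W.scheme).left := SchemeOver.isIntegral_left _
  haveI : AlgebraicGeometry.IsReduced (Spec (CommRingCat.of (W.PieceRing c d))) :=
    isReduced_of_isOpenImmersion (W.pieceι c d).left
  exact (affine_isReduced_iff (CommRingCat.of (W.PieceRing c d))).mp inferInstance

end WeierstrassCurve
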